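import Literature.MathematicalPhysics.QuantumFieldTheory.BalabanImbrieJaffe1984to88.BIJ88WalkFormLocated309
import Literature.MathematicalPhysics.QuantumFieldTheory.BalabanImbrieJaffe1984to88.BIJ88ExpansionSumBound305
import Literature.MathematicalPhysics.QuantumFieldTheory.BalabanImbrieJaffe1984to88.BIJ88W6PrimeVsupp

/-!
# `BalabanImbrieJaffe1984to88.BIJ88ActivityWalkBound309` — T. Bałaban, J. Imbrie, A. Jaffe, *Effective action and cluster properties of the
abelian Higgs model*, Commun. Math. Phys. **114** (1988) 257–315 [BalabanImbrieJaffe1988]: p. 306 [PDF 50] (Sect. 5.13: *"Given some region X,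
a union of □_i, we sum Γ over all subsets of {i ∈ I: □_i ⊂ X}, such that X is a single cluster. … Here s = {s_i: □_i ⊂ X}, and ⟨·⟩_{s_Γ,X} is
defined by integrating over the fields in X only"*, PDF 50 L30–31 and the line after (5.13.3)), p. 307 [PDF 51] L2–5 (*"Each time some □_j's
are joined, we have s-derivatives, which produce functional derivatives, chains of covariances C_ω(α), and factors ℱ = O(e^{−cr(e_k)})"*) and
p. 309 [PDF 53] L12–15 (*"Let us drop the prime, and prove that |g₃(H_β, X_β)| ≦ (e^β(L^kε/ε₀)^{1/4−α})^{[|H_β| + β′|X_β∖H_β|]}. (5.14.4) … The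
proof of this estimate is similar to the one for g₂"*) — **THE ACTIVITY OF A POLYMER OF AT LEAST TWO CUBES IS BOUNDED BY THE SUPREMUM OVER THE
INTERPOLATION CUBE OF THE WALK FORM OF ITS TOP `s`-DERIVATIVE**.

For a region `X` of at least two cubes only `Γ = X` makes `X` a single cluster (`BIJ88PolymerRep5134.g1_of_two_le`), so the printed activity is
ONE iterated integral `g₁(X) = [X connected]·∫ds_X (∂/∂s_X)⟨Π_{□_i⊂X} f(□_i)⟩_{s,X}`; THIS FILE puts the pieces of the tree together for the
ESTIMATE of Sect. 5.13/5.14 at the level of one polymer: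
* §1 `g1_zG_eq_ite_iterInt` — the corner-form activity `g1 adj (zG …) X` of the §5.13 Gaussian model IS that iterated unit-interval integral of the
  honest top partial `Dexp L X X` (p25's `BIJ88PolymerRep5134DerivGauss`; `iterInt_eq_cornerSum` of `BIJ88PolymerRep5134Deriv` on the smooth
  squashed family `Dsq`, which agrees with `Dexp` on the cube); `abs_g1_zG_le_of_forall_cube` — hence `|g₁(X)| ≤ sup_{s∈[0,1]^I} |∂_X⟨…⟩_{s,X}|`
  (`BIJ88ExpansionSumBound305.abs_iterInt_le`);
* §2 `Dexp_eq_sum_trains_of_cbInf` — on the cube the top partial is p13's walk form (5.13.3) (the seam `BIJ88WalkFormIntegrated5133.Dexp_eq_dexp`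
  ∘ `BIJ88WalkForm5133.dexp_eq_sum_trains`, smooth class `C_b^∞`), i.e. `Σ_{σ∈smallParts Γ} (−1)^{|σ|} Σ_{P∈setPartitions σ} ⟨(Π_{c∈P} 𝕋_c)
  Π_{□_i⊂X} f(□_i)⟩_{s,X}`; **`abs_g1_zG_le_sum`** — so bounds `B(σ,P)` on the train expectations, uniform on the cube, give
  `|g₁(X)| ≤ Σ_σ Σ_P B(σ,P)` (p. 307: the estimate of `g₂` is a sum over the vertex structures and walks);
* §3 `actIn_eq_g1`, **`abs_actIn_le_sum`** — the same for the prime-dropped located activities `g₃(H, X″)` of this lineage's model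
  (`BIJ88W6PrimeVsupp.actIn`, the currency of the leaf `h5144three` of the C2.Eq5.14.5 heads): for `|X″| ≥ 2` the prime changes nothing and the
  observables are p25's located derivative observables `fD_H(□_i)` on p36's slot data, which are `C_b^∞` (`BIJ88SlotFactorsSmooth308.cbInf_fD_uD`).
The bounds `B(σ,P)` themselves — trains as sums over end data (`BIJ88TrainsDsetExpansion306`), cube products (`BIJ88CubeProductDset306`), slot
costs (`BIJ88ChiSlotDsetBound309`, `BIJ88CubeSlotCosts309`), Gaussian shell factors (`BIJ88GaussShellInterpolated309`), walk-kernel decay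
(`BIJ88WalkKernelDecay307`) — are the business of the companion files; here they are hypotheses.

statement-level skeleton of published theorems with citation tags; proofs where landed; nothing here is a claim about the Yang–Mills mass gap

PDF held: `paper:balaban1988-cmp114-bij-abelian-higgs-effective-action` (journal page = PDF page + 256); pages re-read this session as text:
PDF 50 (p. 306) L30–31, PDF 51 (p. 307) L2–20, PDF 53 (p. 309) L10–15.

CITATION HEADER (lean-in-tree rule).  Part of the lit-balaban TYPED SKELETON (HOME `run/shared/lean/pub/lit-balaban/`), Phase 2, seat p36
(gen 22, unit `lit-balaban-p36`); rows **C2.Eq5.14.3-5.14.4** (member: §f assembly step E4b — the reduction of the located activity to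
cube-uniform bounds on the train expectations) and C2.Eq5.13.3-5.13.4 (member) of `HOME/lit-balaban-r16/ROWS-C2-part2.md` (owner r16,
referee ref-5).  Theorem-only; no definitions, no `Prop` facts; axioms standard.
HONEST SCOPE.  Identities and the triangle inequality; the train bounds `B(σ,P)` are hypotheses; a region is asked to carry at least one site
(`∃ x, blk x ∈ X`, the base colouring of p13's walk form).  NOT summit progress; NOT continuum; NOT Clay.
-/

noncomputable section

namespace Literature.MathematicalPhysics.QuantumFieldTheory.BalabanImbrieJaffe1984to88.BIJ88ActivityWalkBound309

open MeasureTheory Finset Matrix Function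
open scoped BigOperators
open Literature.Probability.LatticeModels (setPartitions)
open BIJ88DirichletForms305 (interpForm interpForm_posDef quadForm_interpForm_ge quadForm_interpForm_le)
open BIJ88FTCExpansion305 (iterInt)
open BIJ88ExpansionSumBound305 (abs_iterInt_le mem_unitCube_of_cube_zero)
open BIJ88PairingAllOrders5133 (smallParts)
open BIJ88TruncationConnected306 (gexp)
open BIJ88TruncationConnected5133 (bmat)
open BIJ88WalkForm5133 (trains dexp_eq_sum_trains)
open BIJ88Clusters5134 (cornerSum act)
open BIJ88PolymerRep5134 (g1 IsConn corner g1_of_two_le)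
open BIJ88PolymerRep5134Gauss (obs prec src zG)
open BIJ88PolymerRep5134Deriv (iterInt_eq_cornerSum)
open BIJ88PolymerRep5134DerivGauss (Dexp Dsq exists_box_subset_good contDiff_expectSq continuous_Dsq hasDerivAt_Dsq Dsq_empty_corner
  Dsq_eq_Dexp_of_mem_cube iterInt_congr_cube)
open BIJ88WalkFormIntegrated5133 (Dexp_eq_dexp posDef_ΔX formLower_ΔX formUpper_ΔX interpForm_X)
open BIJ88SmoothFactors5133 (CbInf)
open BIJ88Expansion5143 (g3 prime prime_of_not)
open BIJ88Sect5Statements (CutoffProfile)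
open BIJ88Expansion5143Gauss (fD)
open BIJ88SlotMomentsGauss308 (uD)
open BIJ88Eq5145CornerModel (slotB slotY)
open BIJ88Eq5145CornerUrsell (cubeIn)
open BIJ88W6PrimeVsupp (actIn)

variable {α I : Type} [Fintype α] [DecidableEq α] [Fintype I] [DecidableEq I]
  (blk : α → I) (Δ : Matrix α α ℝ) (ℱ : α → ℝ) (f : I → (α → ℝ) → ℝ) (adj : I → I → Prop) [DecidableRel adj]

/-! ## §1  The activity of a polymer of at least two cubes is one iterated integral of the top partial -/

/-- **`g₁(X) = [X connected]·∫ds_X (∂/∂s_X)⟨Π_{□_i⊂X} f(□_i)⟩_{s,X}` for `|X| ≥ 2`** on the §5.13 Gaussian model (p. 306: *"we sum Γ over all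
subsets of {i ∈ I: □_i ⊂ X}, such that X is a single cluster"* — only `Γ = X` qualifies, `BIJ88PolymerRep5134.g1_of_two_le`): the corner-form
activity of the corner expectations `zG` is the iterated unit-interval integral (coordinates of `X` in the order of `L`, the others frozen at `0`) of
the honest top partial `Dexp L X X` of `s ↦ ⟨Π f(□_i)⟩_{s,X}`. [cite: BalabanImbrieJaffe1988, p.306 (Sect. 5.13); (5.13.3) p.305] -/
theorem g1_zG_eq_ite_iterInt (hΔ : Δ.PosDef) (hfm : ∀ i, Measurable (f i)) (hfb : ∀ i, ∃ K, ∀ φ, |f i φ| ≤ K)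
    {L : List I} (hL : L.Nodup) {X : Finset I} (hX : X ⊆ L.toFinset) (h2 : 2 ≤ X.card) :
    g1 adj (zG blk Δ ℱ f) X = if IsConn adj X then iterInt (L.filter (· ∈ X)) (Dexp blk Δ ℱ f L X X) 0 else 0 := by
  rw [g1_of_two_le adj _ h2]
  split_ifs with hc
  · obtain ⟨δ, hδ, hbox⟩ := exists_box_subset_good blk Δ hΔ X
    have hsm := contDiff_expectSq blk Δ ℱ f hfm hfb X hδ hbox
    have h := iterInt_eq_cornerSum hL (Dsq blk Δ ℱ f hδ L X) (fun Γ => continuous_Dsq blk Δ ℱ f hsm L Γ)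
      (fun Γ k hk hkΓ s => hasDerivAt_Dsq blk Δ ℱ f hsm hL hk hkΓ s) hX
    simp only [Dsq_empty_corner] at h
    rw [act, ← h]
    exact iterInt_congr_cube (fun σ hσ => Dsq_eq_Dexp_of_mem_cube blk Δ ℱ f hδ L X X hσ) _ 0
      fun _ => ⟨le_rfl, zero_le_one⟩
  · rfl

/-- **`|g₁(X)| ≤ sup_{s∈[0,1]^I} |(∂/∂s_X)⟨Π_{□_i⊂X} f(□_i)⟩_{s,X}|` for `|X| ≥ 2`** (each `∫₀¹` bounded by the supremum of its integrand,
`BIJ88ExpansionSumBound305.abs_iterInt_le`; the cube over `X` based at `0` lies in the unit cube). [cite: BalabanImbrieJaffe1988, p.306–307 (Sect. 5.13)] -/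
theorem abs_g1_zG_le_of_forall_cube (hΔ : Δ.PosDef) (hfm : ∀ i, Measurable (f i)) (hfb : ∀ i, ∃ K, ∀ φ, |f i φ| ≤ K)
    {X : Finset I} (h2 : 2 ≤ X.card) {Bd : ℝ} (hB0 : 0 ≤ Bd)
    (hB : ∀ s : I → ℝ, (∀ i, 0 ≤ s i ∧ s i ≤ 1) → |Dexp blk Δ ℱ f (univ : Finset I).toList X X s| ≤ Bd) :
    |g1 adj (zG blk Δ ℱ f) X| ≤ Bd := by
  rw [g1_zG_eq_ite_iterInt blk Δ ℱ f adj hΔ hfm hfb (nodup_toList _)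
    (fun i _ => List.mem_toFinset.2 (mem_toList.2 (mem_univ i))) h2]
  split_ifs
  · exact abs_iterInt_le _ _ 0 Bd fun s hs h0 => hB s (mem_unitCube_of_cube_zero hs h0)
  · rwa [abs_zero]

/-! ## §2  On the cube the top partial is the walk form (5.13.3); bounds on the trains bound the activity -/

/-- **THE WALK FORM OF `∂_Γ⟨Π_{□_i⊂X} f(□_i)⟩_{s,X}` ON THE UNIT CUBE, FACTORS IN `C_b^∞`** (the seam `BIJ88WalkFormIntegrated5133.Dexp_eq_dexp` composed
with p13's `BIJ88WalkForm5133.dexp_eq_sum_trains` for the concrete smooth class `C_b^∞`; cf. the integrated display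
`BIJ88WalkFormIntegrated5133.expect_one_eq_expansionSum_trains_of_cbInf`): for `Δ ≻ 0` with form bounds `c₀‖v‖² ≤ ⟨v,Δv⟩ ≤ C₀‖v‖²`, factors
`f(□_i) ∈ C_b^∞`, a duplicate-free list `L ⊇ Γ`, a region `X` with a site, and `s ∈ [0,1]^I`:
`∂_Γ⟨Π f(□_i)⟩_{s,X} = Σ_{σ∈smallParts Γ} (−1)^{|σ|} Σ_{P∈setPartitions σ} ⟨(Π_{c∈P} 𝕋_c) Π_{□_i⊂X} f(□_i)⟩_{s,X}`,
`𝕋_c = ∂_{C_s𝔫(c)ℱ} + ½Σ_{pq}(C_s𝔫(c))_{pq}∂_p∂_q`, `C_s = (prec X s)⁻¹`. [cite: BalabanImbrieJaffe1988, §5.13 Eq. (5.13.3) p.306] -/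
theorem Dexp_eq_sum_trains_of_cbInf (hΔ : Δ.PosDef) {c₀ C₀ : ℝ} (hc₀ : 0 < c₀)
    (hcΔ : ∀ v, c₀ * (v ⬝ᵥ v) ≤ v ⬝ᵥ (Δ *ᵥ v)) (hCΔ : ∀ v, v ⬝ᵥ (Δ *ᵥ v) ≤ C₀ * (v ⬝ᵥ v))
    (hf : ∀ i, CbInf (f i)) {L : List I} (hL : L.Nodup) (X : Finset I) (hXs : ∃ x, blk x ∈ X) {Γ : Finset I}
    (hΓ : ∀ i ∈ Γ, i ∈ L) {s : I → ℝ} (hs : ∀ i, 0 ≤ s i ∧ s i ≤ 1) :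
    Dexp blk Δ ℱ f L X Γ s
      = ∑ σ ∈ smallParts Γ, (-1 : ℝ) ^ σ.card *
          ∑ P ∈ setPartitions σ, gexp (prec blk Δ X s) (src blk ℱ X)
            (trains (src blk ℱ X) (prec blk Δ X s)⁻¹
              (fun b => bmat (fun x : BIJ88PolymerRep5134Gauss.Site blk X => blk x.1) (Δ.submatrix Subtype.val Subtype.val) s b
                + (bmat (fun x : BIJ88PolymerRep5134Gauss.Site blk X => blk x.1) (Δ.submatrix Subtype.val Subtype.val) s b)ᵀ)
              P.toList (obs blk f X)) := by
  obtain ⟨x, hx⟩ := hXs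
  rw [Dexp_eq_dexp blk ℱ f hΔ hc₀ hcΔ hCΔ (fun i => (hf i).measurable) (fun i => (hf i).bdd) hL X hΓ hs,
    dexp_eq_sum_trains (fun x : BIJ88PolymerRep5134Gauss.Site blk X => blk x.1) (posDef_ΔX blk hΔ X) hc₀ (formLower_ΔX blk hcΔ X)
      (formUpper_ΔX blk hCΔ X) hs (src blk ℱ X) CbInf (fun G hG => hG.nice) (fun G u hG => hG.fderiv_apply u)
      (CbInf.obs blk f X fun i _ => hf i) (fun _ => ⟨x, hx⟩) Γ, interpForm_X]

/-- **`|g₁(X)| ≤ Σ_{σ∈smallParts X} Σ_{P∈setPartitions σ} B(σ,P)` for `|X| ≥ 2`**, given bounds `|⟨(Π_{c∈P} 𝕋_c) Π_{□_i⊂X} f(□_i)⟩_{s,X}| ≤ B(σ,P)`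
uniform in `s ∈ [0,1]^I` (p. 307: *"Each time some □_j's are joined, we have s-derivatives, which produce functional derivatives, chains of
covariances C_ω(α) …"* — the estimate of the activity is the sum over the vertex structures `σ` and the groupings `P` into trains).
[cite: BalabanImbrieJaffe1988, p.306–307 (Sect. 5.13); (5.13.3) p.306] -/
theorem abs_g1_zG_le_sum (hΔ : Δ.PosDef) {c₀ C₀ : ℝ} (hc₀ : 0 < c₀)
    (hcΔ : ∀ v, c₀ * (v ⬝ᵥ v) ≤ v ⬝ᵥ (Δ *ᵥ v)) (hCΔ : ∀ v, v ⬝ᵥ (Δ *ᵥ v) ≤ C₀ * (v ⬝ᵥ v))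
    (hf : ∀ i, CbInf (f i)) {X : Finset I} (h2 : 2 ≤ X.card) (hXs : ∃ x, blk x ∈ X)
    {Bd : Finset (Finset I) → Finset (Finset (Finset I)) → ℝ} (hB0 : ∀ σ ∈ smallParts X, ∀ P ∈ setPartitions σ, 0 ≤ Bd σ P)
    (hB : ∀ s : I → ℝ, (∀ i, 0 ≤ s i ∧ s i ≤ 1) → ∀ σ ∈ smallParts X, ∀ P ∈ setPartitions σ,
      |gexp (prec blk Δ X s) (src blk ℱ X)
        (trains (src blk ℱ X) (prec blk Δ X s)⁻¹
          (fun b => bmat (fun x : BIJ88PolymerRep5134Gauss.Site blk X => blk x.1) (Δ.submatrix Subtype.val Subtype.val) s b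
            + (bmat (fun x : BIJ88PolymerRep5134Gauss.Site blk X => blk x.1) (Δ.submatrix Subtype.val Subtype.val) s b)ᵀ)
          P.toList (obs blk f X))| ≤ Bd σ P) :
    |g1 adj (zG blk Δ ℱ f) X| ≤ ∑ σ ∈ smallParts X, ∑ P ∈ setPartitions σ, Bd σ P := by
  refine abs_g1_zG_le_of_forall_cube blk Δ ℱ f adj hΔ (fun i => (hf i).measurable) (fun i => (hf i).bdd) h2
    (sum_nonneg fun σ hσ => sum_nonneg fun P hP => hB0 σ hσ P hP) fun s hs => ?_
  rw [Dexp_eq_sum_trains_of_cbInf blk Δ ℱ f hΔ hc₀ hcΔ hCΔ hf (nodup_toList _) X hXs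
    (fun i _ => mem_toList.2 (mem_univ i)) hs]
  refine (abs_sum_le_sum_abs _ _).trans (sum_le_sum fun σ hσ => ?_)
  rw [abs_mul, abs_pow, abs_neg, abs_one, one_pow, one_mul]
  exact (abs_sum_le_sum_abs _ _).trans (sum_le_sum fun P hP => hB s hs σ hσ P hP)

/-! ## §3  The prime-dropped located activities of the lineage's model -/

section Located

variable (χ : CutoffProfile) {ι υ : Type} [DecidableEq ι] [DecidableEq υ]
variable {p ek : ℝ} {B : Finset ι} {Φ : ι → (α → ℝ) → ℝ} {c : ι → ℝ} {Ys : Finset υ} {V : υ → (α → ℝ) → ℝ}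
variable (cube : ↥B ⊕ ↥Ys → I) (Λ : Finset I)

omit [Fintype α] [DecidableEq α] [Fintype I] in
/-- **the interpolated coupling at a corner is positive definite** with the form bounds of `Δ` (the corner `1_Λ` lies in the unit cube).
[cite: BalabanImbrieJaffe1988, p.305 (Sect. 5.13)] -/
theorem corner_mem_cube (i : I) : 0 ≤ corner ℝ Λ i ∧ corner ℝ Λ i ≤ 1 := by
  simp only [corner]
  split_ifs <;> norm_num

/-- **for a polymer that is not a slot-free single cube the prime changes nothing**: `g₃′(H, X″) = g₃(H, X″) = g₁` of the corner expectations
of the located derivative observables (p. 309: *"If |X_β| = 1, H_β = ∅, we write g₃(∅,X_β) = 1 + g₃′(∅,X_β) … Let us drop the prime"*).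
[cite: BalabanImbrieJaffe1988, (5.14.3)–(5.14.4) p.309] -/
theorem actIn_eq_g1 (X : Finset I) (t : ℝ) {L : Type*} [DecidableEq L] (γ : L → ↥(slotB B Ys cube X) ⊕ ↥(slotY B Ys cube X))
    {H : Finset L} {X'' : Finset I} (hHX : ¬ (H = ∅ ∧ X''.card = 1)) :
    actIn blk Δ ℱ adj χ p ek B Φ c Ys V cube Λ X t γ H X'' =
      g1 adj (zG blk (interpForm blk Δ (corner ℝ Λ)) ℱ
        (fD (uD χ p ek (slotB B Ys cube X) (fun b : ↥B => Φ b) (fun b : ↥B => c b) (slotY B Ys cube X) (fun Y : ↥Ys => V Y) t)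
          (cubeIn cube X) γ H)) X'' := by
  rw [actIn, prime_of_not _ hHX, g3]

/-- **THE LOCATED ACTIVITY OF A POLYMER OF AT LEAST TWO CUBES IS BOUNDED BY THE SUM OVER VERTEX STRUCTURES AND TRAINS OF CUBE-UNIFORM BOUNDS
ON THE TRAIN EXPECTATIONS** (p. 309: *"The proof of this estimate is similar to the one for g₂"*; p. 307 for `g₂`): for `|X″| ≥ 2` (the prime is
void), `Δ ≻ 0` with form bounds, linear χ-slot fields `Φ_b`, `c_b ≠ 0`, `V_Y ∈ C_b^∞`, `0 < t`, `t·e_k < 1` (so that the located derivative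
observables `fD_H(□_i)` are `C_b^∞`, `BIJ88SlotFactorsSmooth308.cbInf_fD_uD`) and a site in `X″`: bounds `B(σ,P)` on
`|⟨(Π_{c∈P} 𝕋_c) Π_{□_i⊂X″} fD_H(□_i)⟩_{s,X″}|` for the coupling `Δ_{1_Λ}`, uniform in `s ∈ [0,1]^I`, give
`|actIn … H X″| ≤ Σ_{σ∈smallParts X″} Σ_{P∈setPartitions σ} B(σ,P)`. [cite: BalabanImbrieJaffe1988, (5.14.4) p.309; p.306–307 (Sect. 5.13)] -/
theorem abs_actIn_le_sum (hΔ : Δ.PosDef) {c₀ C₀ : ℝ} (hc₀ : 0 < c₀)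
    (hcΔ : ∀ v, c₀ * (v ⬝ᵥ v) ≤ v ⬝ᵥ (Δ *ᵥ v)) (hCΔ : ∀ v, v ⬝ᵥ (Δ *ᵥ v) ≤ C₀ * (v ⬝ᵥ v))
    (hek : 0 < ek) {t : ℝ} (ht : 0 < t) (h1 : t * ek < 1) (hΦ : ∀ b ∈ B, IsLinearMap ℝ (Φ b)) (hc : ∀ b ∈ B, c b ≠ 0)
    (hV : ∀ Y ∈ Ys, CbInf (V Y)) (X : Finset I) {L : Type*} [DecidableEq L]
    (γ : L → ↥(slotB B Ys cube X) ⊕ ↥(slotY B Ys cube X)) (H : Finset L) {X'' : Finset I} (h2 : 2 ≤ X''.card)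
    (hXs : ∃ x, blk x ∈ X'')
    {Bd : Finset (Finset I) → Finset (Finset (Finset I)) → ℝ} (hB0 : ∀ σ ∈ smallParts X'', ∀ P ∈ setPartitions σ, 0 ≤ Bd σ P)
    (hB : ∀ s : I → ℝ, (∀ i, 0 ≤ s i ∧ s i ≤ 1) → ∀ σ ∈ smallParts X'', ∀ P ∈ setPartitions σ,
      |gexp (prec blk (interpForm blk Δ (corner ℝ Λ)) X'' s) (src blk ℱ X'')
        (trains (src blk ℱ X'') (prec blk (interpForm blk Δ (corner ℝ Λ)) X'' s)⁻¹
          (fun b => bmat (fun x : BIJ88PolymerRep5134Gauss.Site blk X'' => blk x.1)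
              ((interpForm blk Δ (corner ℝ Λ)).submatrix Subtype.val Subtype.val) s b
            + (bmat (fun x : BIJ88PolymerRep5134Gauss.Site blk X'' => blk x.1)
              ((interpForm blk Δ (corner ℝ Λ)).submatrix Subtype.val Subtype.val) s b)ᵀ)
          P.toList
          (obs blk (fD (uD χ p ek (slotB B Ys cube X) (fun b : ↥B => Φ b) (fun b : ↥B => c b) (slotY B Ys cube X)
            (fun Y : ↥Ys => V Y) t) (cubeIn cube X) γ H) X''))| ≤ Bd σ P) :
    |actIn blk Δ ℱ adj χ p ek B Φ c Ys V cube Λ X t γ H X''| ≤ ∑ σ ∈ smallParts X'', ∑ P ∈ setPartitions σ, Bd σ P := by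
  have hHX : ¬ (H = ∅ ∧ X''.card = 1) := fun h => by omega
  rw [actIn_eq_g1 blk Δ ℱ adj χ cube Λ X t γ hHX]
  have hΔ' : (interpForm blk Δ (corner ℝ Λ)).PosDef := interpForm_posDef blk hΔ (corner_mem_cube Λ)
  exact abs_g1_zG_le_sum blk (interpForm blk Δ (corner ℝ Λ)) ℱ _ adj hΔ' hc₀
    (fun v => quadForm_interpForm_ge blk hcΔ (corner_mem_cube Λ) v) (fun v => quadForm_interpForm_le blk hCΔ (corner_mem_cube Λ) v)
    (fun i => BIJ88SlotFactorsSmooth308.cbInf_fD_uD χ p (slotB B Ys cube X) (slotY B Ys cube X) hek ht h1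
      (fun b _ => hΦ b.1 b.2) (fun b _ => hc b.1 b.2) (fun Y _ => hV Y.1 Y.2) (cubeIn cube X) γ H i)
    h2 hXs hB0 hB

end Located

end Literature.MathematicalPhysics.QuantumFieldTheory.BalabanImbrieJaffe1984to88.BIJ88ActivityWalkBound309

end
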